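import Summits.Langlands.Langlands.Theorems.PhantomRMYoshidaResiduallyYoshidaLiftingSplit
import HarnessLib

/-!
# Route `PhantomRMYoshida`, crux `ResiduallyYoshidaLifting` (stmt-Langlands-13639), line
# `sector-klingen-split`: the anchor R1c `stub_selmerAnchor` measured against the route target

Stub-worker of lead prover-line-stmt-Langlands-13639-c3-0 (2026-08-17), registered sub-goal
`stub_selmerAnchor_of_target` (`--supports stmt-Langlands-13639`).

The registered stub R1c `stub_selmerAnchor` of the checked skeleton
`Cruxes/ResiduallyYoshidaLifting/Lines/sector_klingen_split.lean` (rev 4) — "on a generic admissible fibre, a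
residual cocycle `B` that is not a coboundary and is realised by SOME irreducible `Sh`-point is realised by an
AUTOMORPHIC irreducible point of the ordinary family, symplectic, Greenberg-ordinary and residually
distinguished at `p` of some shape `a ≡ (0,0,1,1) mod (p-1)`" — is OPEN IN PRINT (a `Λ`-adic converse-Ribet /
automorphic realisation of a prescribed Selmer class at the Yoshida point, strategist census §7 R1(c)).  This
file records, kernel-checked, that it carries NO risk beyond the route's own target `PhantomRMSector`:
under the target the realising irreducible `Sh`-point `ρ` offered by the hypothesis is itself automorphic
(oddness of `σ̄, σ̄'` from `DetC`, `isOdd_of_detC`, exactly as in `everyShIsKlingenLimit_of_phantomRMSector`,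
p116982), and `ρ` witnesses the conclusion with the weight-(2,2) shape `a := (0,0,1,1)` itself, the `Sh`
multiplier `ε⁻¹`, the Greenberg-ordinary / residually-distinguished clauses of `Sh ρ`, and the SAME realisation
triple `(P, rint, h)`.  Nothing is asserted: the target enters only as a hypothesis.
-/

noncomputable section

-- `Summit.Langlands.Langlands.…` (summit = sub-problem name, D-0017 layout) trips `dupNamespace` on every decl.
set_option linter.dupNamespace false
set_option autoImplicit false

open IsDedekindDomain Filter
open Literature.NumberTheory.GaloisRepresentations Literature.NumberTheory.Automorphic
open Summit.Langlands.Langlands.Cruxes.ResiduallyYoshidaLifting.YoshidaDivisorSelmerCount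
open Summit.Langlands.Langlands.Cruxes.ResiduallyYoshidaLifting.SectorSplit

namespace Summit.Langlands.Langlands.Cruxes.ResiduallyYoshidaLifting.SectorKlingenSplit

/-- **R1c ≤ route target** (registered sub-goal `stub_selmerAnchor_of_target`): the route target
`PhantomRMSector` implies the registered anchor statement `stub_selmerAnchor` verbatim.  Given the realising
irreducible `Sh`-point `ρ` of the hypothesis, the target makes `ρ` automorphic (`σ̄, σ̄'` are odd by
`isOdd_of_detC`; `DetC`/`Sh`/`Aut` are definitionally the target's inline clauses), and `ρ₁ := ρ` with
`a := ![0, 0, 1, 1]`, `ν :=` the `Sh` multiplier and the same `(P, rint, h)` is the required witness. -/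
theorem stub_selmerAnchor_of_target :
    Summit.Langlands.Langlands.Theses.PhantomRMYoshida.PhantomRMSector → (∀ (p : ℕ) [Fact p.Prime], p ≠ 2 →
    ∀ (k : Type) [Field k] [CharP k p] [IsAlgClosed k]
    [TopologicalSpace k] [DiscreteTopology k] (red : Valued.integer (PadicAlgCl p) →+* k)
    (σ σ' : FramedGaloisRep ℚ k 2) (hcpt : isCompact_glFiniteIntegralLevel 4 ℚ) (ι : PadicAlgCl p ≃+* ℂ)
    (B : Field.absoluteGaloisGroup ℚ → Matrix (Fin 2) (Fin 2) k),
    σ.toGaloisRep.IsIrreducible → σ'.toGaloisRep.IsIrreducible → DetC p k σ σ' →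
    (¬ ∃ g : GL (Fin 2) k, ∀ x, g * σ x * g⁻¹ = σ' x) → GenericSector p k σ σ' →
    (¬ ∃ X : Matrix (Fin 2) (Fin 2) k, ∀ g, B g = (σ g).val * X - X * (σ' g).val) →
    (∃ ρ : FramedGaloisRep ℚ (PadicAlgCl p) 4, ρ.toGaloisRep.IsIrreducible ∧ Sh p k red σ σ' ρ ∧
      ∃ (P : GL (Fin 4) (PadicAlgCl p))
        (rint : Field.absoluteGaloisGroup ℚ →* GL (Fin 4) (Valued.integer (PadicAlgCl p))) (h : GL (Fin 4) k),
        (∀ g, Matrix.GeneralLinearGroup.map (Valued.integer (PadicAlgCl p)).subtype (rint g) = P⁻¹ * ρ g * P) ∧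
        (∀ g, (Matrix.GeneralLinearGroup.map red (rint g)).val =
          h.val * Matrix.reindex finSumFinEquiv finSumFinEquiv
            (Matrix.fromBlocks (σ g).val (B g) 0 (σ' g).val) * (h⁻¹).val)) →
    ∃ ρ₁ : FramedGaloisRep ℚ (PadicAlgCl p) 4, ρ₁.toGaloisRep.IsIrreducible ∧ Aut p hcpt ι ρ₁ ∧
      (∃ a : Fin 4 → ℕ, a 0 = 0 ∧ (a 1 : ZMod (p - 1)) = 0 ∧ (a 2 : ZMod (p - 1)) = 1 ∧ (a 3 : ZMod (p - 1)) = 1 ∧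
        (∃ ν : Field.absoluteGaloisGroup ℚ → PadicAlgCl p, ρ₁.IsSymplecticWithMultiplierFun ν) ∧
        ∀ v : HeightOneSpectrum (NumberField.RingOfIntegers ℚ), ((p : ℕ) : NumberField.RingOfIntegers ℚ) ∈ v.asIdeal →
          ρ₁.IsGreenbergOrdinaryOfShapeAt v a ∧ ρ₁.IsResiduallyDistinguishedAt v a) ∧
      ∃ (P : GL (Fin 4) (PadicAlgCl p))
        (rint : Field.absoluteGaloisGroup ℚ →* GL (Fin 4) (Valued.integer (PadicAlgCl p))) (h : GL (Fin 4) k),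
        (∀ g, Matrix.GeneralLinearGroup.map (Valued.integer (PadicAlgCl p)).subtype (rint g) = P⁻¹ * ρ₁ g * P) ∧
        (∀ g, (Matrix.GeneralLinearGroup.map red (rint g)).val =
          h.val * Matrix.reindex finSumFinEquiv finSumFinEquiv
            (Matrix.fromBlocks (σ g).val (B g) 0 (σ' g).val) * (h⁻¹).val)) := by
  intro hT p _ hp k _ _ _ _ _ red σ σ' hcpt ι B hσ hσ' hdet hnc _hG _hncB hreal
  obtain ⟨ρ, hρ, hSh, P, rint, h, hfr, hred⟩ := hreal
  have hAut : Aut p hcpt ι ρ :=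
    hT p hp k red σ σ' hcpt ι ρ (isOdd_of_detC hdet).1 (isOdd_of_detC hdet).2 hσ hσ' hdet hnc hρ hSh
  refine ⟨ρ, hρ, hAut, ⟨![0, 0, 1, 1], rfl, ?_, ?_, ?_, ⟨_, hSh.1⟩, fun v hv => hSh.2.1 v hv⟩,
    P, rint, h, hfr, hred⟩
  · simp
  · simp
  · simp

end Summit.Langlands.Langlands.Cruxes.ResiduallyYoshidaLifting.SectorKlingenSplit

end
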